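import Summits.QuantumFields.BalabanUV.Beta.D1BFx.RProjectorRange
import Summits.QuantumFields.BalabanUV.Beta.D1BFx.RJetProjector
import Summits.QuantumFields.BalabanUV.Beta.D1BFx.RProjectorJet

/-!
# `BalabanUV.Beta.D1BFx.RdotBlockRange` — road «BF-x» for binder row D1, leaves A3.a′∕A3.b′ (the projector words): **`R·G′` ANNIHILATES THE
# BLOCK INDICATORS** — `Σ'_z R(x,z)·(G′Q′*)(z,w) = 0` and `Σ_{y ∈ B(w)} (G′ − P·G′)(x,y) = 0` — so the `1_B ⊗ p` column of the `Q̇`-slot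
# `qAnti` drops out of `Rdot`'s `V`-corner `R·G′·V·P` (one of its would-be five rank-one pairs vanishes identically)

HONEST DEPENDENCY (page 1, mandatory): continuum YM on T⁴ ⇐ BetaPertH ∧ nine spine estimates (0/9 proved); BetaPertH ⇐ (D1) ∧ (D4) ∧
CAP+tail; G-an2-4 gates asym, D1 and NE2/3/4.  HONEST FRAMING (cell contract, verbatim): «discharging `BetaPertH` makes Bałaban's UV
stability UNCONDITIONAL — a real constructive-QFT result; it is NOT the continuum limit and NOT the Clay problem.»  THIS MODULE DISCHARGES
NOTHING of the wall: [folklore] Fubini bookkeeping BY NAME over leaf-09-g2's `RProjector`∕`RProjectorRange` (`gq`, `Pgt`, `Pgt_symm`,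
`abs_Pgt_le`, `tsum_gq_mul_Pgt`, `Gk_symm`), the typer's `GhostLeg` (`Ggh`, `Ggh_apply`), leaf-05-g3's `RJetProjector` (`Rgt`, `Rgt_apply`),
leaf-07-g2's `RProjectorJet` (`RG`) and `B5Hk103ScalarZd` (`summable_Gk_row`).  No `def`, no `Prop` minted, nothing printed asserted, no citation,
0 sorry.  0 wall binders; NOT the A3 bounds, NOT (K), NOT D1, NOT `BetaPertH`, NOT continuum, NOT Clay.

ABSOLUTE RULE (cell charter, verbatim): «No internally-minted statement may enter as a cited fact. Every hypothesis is either kernel-proved in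
this package or a verbatim quotation of a PUBLISHED theorem with page reference. The manuscript(s) under audit are NOT citable for their own
disputed steps — they are the thing under adjudication; programme-internal (2001/route/tribunal) claims are never citable.»

WHY (unit b2b-balaban-beta-d1-formalise-leaf-04 gen 5, the «D1-BFx-BLK-NUM» numerics, `HOME/…/leaf-04/g5/blknum/BLKNUM-RESULT.md` (F8)).
`RProjectorJet.Rdot = rdotOf (Ggh) (Pgt) (Sgh) (Jq)` with `Sgh = cK·ghCur + cQ·qAnti` and `qAnti κ u x z = n⁻⁴·(1_B(x)·p(z) − p(x)·1_B(z))`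
(`B` = the block of `u`, `p` the axial path function); the `V`-corner `RG ∘ Sgh ∘ P` therefore contains the rank-one term `(RG 1_B) ⊗ (P p)`,
and `RG 1_B = G′1_B − P(G′1_B) = 0` because `G′1_B = (G′Q′*)(·,B)` lies in the range of the projector `P` (J5.0 part 2,
`RProjectorRange.tsum_gq_mul_Pgt`: `Q′G′·P = Q′G′`).  The two engines of BLK-NUM see `‖RG 1_B‖ ≈ 1e−16`; this file is the kernel statement,
for the A3.a′∕A3.b′ seats (one fewer term in every projector word).

CONTENT (all [folklore]; block side `n`, `0 < a`).
* `summable_Pgt_mul_Ggh` — `z ↦ P(x,z)·G′(z,y)` is absolutely summable (`|P| ≤ c_PP`, `summable_Gk_row`).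
* **`tsum_Rgt_mul_gq`** — `Σ'_z R(x,z)·(G′Q′*)(z,w) = 0` (`R = 1 − P`).
* `sum_B_comp_Pgt_Ggh` — `Σ_{y ∈ B(w)} (P ∘ G′)(x,y) = (G′Q′*)(x,w)` (Fubini + `tsum_gq_mul_Pgt`).
* **`sum_B_RG_eq_zero`** — `Σ_{y ∈ B(w)} (G′ − P ∘ G′)(x,y) = 0`.
Unit `b2b-balaban-beta-d1-formalise-leaf-04` (gen 5); `LEAVES-BFx.md` rows A3.a′∕A3.b′ (structure of `SbRblk`).
-/

noncomputable section

namespace Summit.QuantumFields.BalabanUV.Beta.D1BFx.RdotBlockRange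

open Finset
open scoped BigOperators
open Literature.MathematicalPhysics.QuantumFieldTheory.Balaban1983to89
open Literature.MathematicalPhysics.QuantumFieldTheory.Balaban1983to89.Beta
open ExpKernelCalculus (Site MKer comp)
open B6QGQLower276 (X B)
open B5Hk103ScalarZd (Gk gq summable_Gk_row)
open Summit.QuantumFields.BalabanUV.Beta.D1BFx.RProjector (Pgt Pgt_symm abs_Pgt_le cPP)
open Summit.QuantumFields.BalabanUV.Beta.D1BFx.RProjectorRange (tsum_gq_mul_Pgt Gk_symm)
open Summit.QuantumFields.BalabanUV.Beta.D1BFx.GhostLeg (Ggh Ggh_apply)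
open Summit.QuantumFields.BalabanUV.Beta.D1BFx.RJetProjector (Rgt Rgt_apply)
open Summit.QuantumFields.BalabanUV.Beta.D1BFx.RProjectorJet (RG)

variable (n : ℕ) [NeZero n] {a : ℝ}

/-- [folklore] `z ↦ P(x,z)·G′(z,y)` is summable: `P` is entrywise bounded (`abs_Pgt_le`) and the `G′`-column is absolutely summable
(`summable_Gk_row` + symmetry). -/
theorem summable_Pgt_mul_Ggh (ha : 0 < a) (x y : X 4) :
    Summable fun z : X 4 => Pgt n a x z () () * Ggh n a z y () () := by
  have hcol : Summable fun z : X 4 => Gk (d := 4) (n - 1) a y z := summable_Gk_row (n - 1) ha y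
  refine Summable.of_norm_bounded ((hcol.abs).mul_left (cPP 4 (n - 1) a)) fun z => ?_
  rw [Real.norm_eq_abs, abs_mul, Ggh_apply, Gk_symm (n - 1) ha z y]
  refine mul_le_mul_of_nonneg_right ((abs_Pgt_le n ha x z () ()).trans ?_) (abs_nonneg _)
  have he : Real.exp (-(RProjector.deltaPP 4 a * dist (B6QGQLower276.blk (n - 1) x) (B6QGQLower276.blk (n - 1) z))) ≤ 1 := by
    rw [Real.exp_le_one_iff, neg_nonpos]; exact mul_nonneg (RProjector.deltaPP_pos 4 ha).le dist_nonneg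
  have h0 := RProjector.cPP_nonneg 4 (n - 1) ha
  nlinarith

omit [NeZero n] in
/-- [folklore] **`R·(G′Q′*) = 0`**: `Σ'_z R(x,z)·(G′Q′*)(z,w) = 0` for `R = 1 − P` — the columns of `G′Q′*` span the range of `P`
(`RProjectorRange.tsum_gq_mul_Pgt`, `Pgt_symm`). -/
theorem tsum_Rgt_mul_gq (ha : 0 < a) (x w : X 4) : ∑' z : X 4, Rgt n a x z () () * gq (n - 1) a z w = 0 := by
  classical
  have hP : Summable fun z : X 4 => Pgt n a x z () () * gq (n - 1) a z w := by
    refine (RProjectorRange.summable_gq_mul_Pker (n - 1) ha w x).congr fun z => ?_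
    rw [RProjector.Pgt_apply, RProjector.Pker_symm (n - 1) ha x z, mul_comm]
  have hI : Summable fun z : X 4 => (if x = z then (1 : ℝ) else 0) * gq (n - 1) a z w :=
    summable_of_ne_finset_zero (s := {x}) fun z hz => by
      rw [Finset.mem_singleton] at hz
      rw [if_neg (Ne.symm hz), zero_mul]
  have e : (fun z : X 4 => Rgt n a x z () () * gq (n - 1) a z w)
      = fun z => (if x = z then (1 : ℝ) else 0) * gq (n - 1) a z w - Pgt n a x z () () * gq (n - 1) a z w := by
    funext z; rw [Rgt_apply, sub_mul]
  rw [e, hI.tsum_sub hP]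
  have h1 : ∑' z : X 4, (if x = z then (1 : ℝ) else 0) * gq (n - 1) a z w = gq (n - 1) a x w := by
    rw [tsum_eq_single x fun z hz => by rw [if_neg (Ne.symm hz), zero_mul]]
    rw [if_pos rfl, one_mul]
  have h2 : ∑' z : X 4, Pgt n a x z () () * gq (n - 1) a z w = gq (n - 1) a x w := by
    rw [← tsum_gq_mul_Pgt n ha w x ()]
    exact tsum_congr fun z => by rw [Pgt_symm n ha x z () (), mul_comm]
  rw [h1, h2, sub_self]

/-- [folklore] **`Σ_{y ∈ B(w)} (P ∘ G′)(x,y) = (G′Q′*)(x,w)`** (Fubini over the finite block, then `Q′G′·P = Q′G′`). -/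
theorem sum_B_comp_Pgt_Ggh (ha : 0 < a) (x w : X 4) :
    ∑ y ∈ B (n - 1) w, comp (Pgt n a) (Ggh n a) x y () () = gq (n - 1) a x w := by
  have hc : ∀ y : X 4, comp (Pgt n a) (Ggh n a) x y () () = ∑' z : X 4, Pgt n a x z () () * Ggh n a z y () () := by
    intro y
    simp only [comp, Fintype.sum_unique]
  simp_rw [hc]
  rw [← Summable.tsum_finsetSum (fun y _ => summable_Pgt_mul_Ggh n ha x y)]
  have e : ∀ z : X 4, ∑ y ∈ B (n - 1) w, Pgt n a x z () () * Ggh n a z y () () = gq (n - 1) a z w * Pgt n a z x () () := by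
    intro z
    rw [← Finset.mul_sum, Pgt_symm n ha x z () (), mul_comm]
    simp only [Ggh_apply, gq]
  rw [tsum_congr e, tsum_gq_mul_Pgt n ha w x ()]

/-- [folklore] **`R·G′` ANNIHILATES THE BLOCK INDICATORS**: `Σ_{y ∈ B(w)} (G′ − P ∘ G′)(x,y) = 0` — the `1_B`-column of the `Q̇`-slot
`qAnti` contributes nothing to `Rdot`'s `V`-corner `RG ∘ Sgh ∘ P`. -/
theorem sum_B_RG_eq_zero (ha : 0 < a) (x w : X 4) :
    ∑ y ∈ B (n - 1) w, RG (Ggh n a) (Pgt n a) x y () () = 0 := by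
  have e : ∀ y : X 4, RG (Ggh n a) (Pgt n a) x y () () = Ggh n a x y () () - comp (Pgt n a) (Ggh n a) x y () () := fun y => rfl
  simp_rw [e]
  rw [Finset.sum_sub_distrib, sum_B_comp_Pgt_Ggh n ha x w]
  simp only [Ggh_apply, gq, sub_self]

end Summit.QuantumFields.BalabanUV.Beta.D1BFx.RdotBlockRange

end
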